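import Literature.Topology.FourManifolds.NullCobordismBoundaryHomology
import Literature.AlgebraicTopology.Homotopy.WhiteheadTheoremProofs
import Literature.AlgebraicTopology.Homotopy.CompactManifoldCWType
import Literature.AlgebraicTopology.Homotopy.CWTypeCompactBoundaryProofs
import Literature.AlgebraicTopology.SingularHomology.HomologySpheresProofs
import HarnessLib

/-!
# Kervaire–Milnor's Lemma 2.3 (homotopy half): assembly over the remaining deep named facts

Topic `Literature/Topology/FourManifolds`, sibling of `NullCobordismBoundaryHomology.lean`, which
proves the homotopy-theoretic half of Kervaire–Milnor's Lemma 2.3 (*Groups of homotopy spheres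
I*, Ann. of Math. 77 (1963), pp. 506–507; tree named fact
`Literature.Topology.FourManifolds.NullCobordism.isHomotopyEquiv_compl_ball_of_contractibleSpace`)
from six named facts of the tree
(`NullCobordism.isHomotopyEquiv_compl_ball_of_contractibleSpace_of_facts`): Whitehead's theorem
(Hatcher Cor. 4.33), the CW type of compact manifolds without and with boundary (Hatcher
Cor. A.12), Spanier's Thm. 6.3.5, Lefschetz duality (Spanier Thm. 6.3.12) and universal
coefficients (Hatcher Thm. 3.2).  Since then

* universal coefficients was discharged
  (`Literature.AlgebraicTopology.SingularHomology.injective_kroneckerMap_of_free_holds`,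
  `HomologySpheresProofs.lean`);
* Whitehead's Cor. 4.33 was reduced (`whitehead_exists_homotopyEquiv_of_facts`,
  `WhiteheadTheoremProofs.lean`) to Whitehead's theorem for weak homotopy equivalences between CW
  complexes (Hatcher Thm. 4.5, `whitehead_exists_homotopyEquiv_of_isWeakHomotopyEquiv`) and the
  relative-Hurewicz consequence that homology isomorphisms between simply connected spaces are
  weak homotopy equivalences (Miller Cor. 65.7, `isWeakHomotopyEquiv_of_isIso_singularHomologyMap`);
* both CW-type facts were reduced (`exists_cwComplex_homotopyEquiv_of_compactSpace_of_facts`,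
  `CompactManifoldCWType.lean`; `exists_cwComplex_homotopyEquiv_of_compactSpace_boundary_of_facts`,
  `CWTypeCompactBoundaryProofs.lean`) to Hatcher's Thm. A.7
  (`isNeighbourhoodRetract_of_locallyContractibleSpace`) and Prop. A.11
  (`exists_cwComplex_homotopyEquiv_of_dominated`).

This file records the composite reduction, PROVED:
`NullCobordism.isHomotopyEquiv_compl_ball_of_contractibleSpace_of_deep_facts` — the Lemma 2.3
fact follows from exactly these six theory-level named facts of the tree (Hatcher Thm. 4.5,
Miller Cor. 65.7, Hatcher Thm. A.7, Hatcher Prop. A.11, Spanier Thm. 6.3.5, Spanier Thm. 6.3.12),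
everything else in Kervaire–Milnor's printed proof being proved in the tree.  The unconditional
`…_holds` is the specialisation of this theorem to the `_holds` theorems of those six facts, to be
appended to `HomotopySpheresInverse.lean` when they exist.  Nothing is asserted here.

## References

* M. Kervaire, J. Milnor, *Groups of homotopy spheres I*, Ann. of Math. (2) 77 (1963), 504–537:
  proof of Lemma 2.3 (pp. 506–507). [KervaireMilnorAnnals1963]
* A. Hatcher, *Algebraic Topology*, CUP (2002): Thm. 3.2, Thm. 4.5, Cor. 4.33, Thm. A.7,
  Prop. A.11, Cor. A.12. [HatcherAT2002]
* H. Miller, *Lectures on Algebraic Topology*, World Scientific (2020), Cor. 65.7. [Miller2020]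
* E. H. Spanier, *Algebraic Topology* (1966; Springer 1981), Ch. 6 §3, Thm. 5, Thm. 12.
  [Spanier1981]
-/

noncomputable section

open scoped Manifold
open CategoryTheory
open Literature.AlgebraicTopology.SingularHomology Literature.AlgebraicTopology.Homotopy

namespace Literature.Topology.FourManifolds

namespace NullCobordism

/-- **The homotopy theory in Kervaire–Milnor's Lemma 2.3 from the six deep facts.** The named
fact `NullCobordism.isHomotopyEquiv_compl_ball_of_contractibleSpace` (`HomotopySpheresInverse.lean`:
for `M = ∂W'` closed simply connected, `n ≥ 2`, `W'` contractible, both ends `M → K`, `𝕊ⁿ → K` of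
the ball complement `K ≅ W' ∖ i(B̊ⁿ⁺¹)` are homotopy equivalences) follows from: Whitehead's
theorem for weak homotopy equivalences of CW complexes (`hWh`, Hatcher Thm. 4.5), "homology
isomorphisms of simply connected spaces are weak equivalences" (`hHu`, Miller Cor. 65.7 /
relative Hurewicz), Hatcher's Thm. A.7 (`h7`) and Prop. A.11 (`h11`) giving the CW type of
compact manifolds with or without boundary, Spanier's Thm. 6.3.5 (`h635`) and Lefschetz duality
(`h6312`, Spanier Thm. 6.3.12); universal coefficients (Hatcher Thm. 3.2) is now a theorem
(`injective_kroneckerMap_of_free_holds`). PROVED by composing the tree's reductions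
`whitehead_exists_homotopyEquiv_of_facts`, `exists_cwComplex_homotopyEquiv_of_compactSpace_of_facts`,
`exists_cwComplex_homotopyEquiv_of_compactSpace_boundary_of_facts` with
`isHomotopyEquiv_compl_ball_of_contractibleSpace_of_facts`.
[cite: KervaireMilnorAnnals1963, Lemma 2.3, proof (pp. 506–507)] -/
theorem isHomotopyEquiv_compl_ball_of_contractibleSpace_of_deep_facts
    (hWh : whitehead_exists_homotopyEquiv_of_isWeakHomotopyEquiv.{0, 0})
    (hHu : isWeakHomotopyEquiv_of_isIso_singularHomologyMap.{0})
    (h7 : isNeighbourhoodRetract_of_locallyContractibleSpace)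
    (h11 : exists_cwComplex_homotopyEquiv_of_dominated.{0})
    (h635 : ∀ (n : ℕ) (W : Type) [TopologicalSpace W] [T2Space W] [CompactSpace W]
      [ConnectedSpace W] [ChartedSpace (EuclideanHalfSpace (n + 1)) W]
      (h : ∃ z : relativeSingularHomology ℤ ℤ W ((𝓡∂ (n + 1)).boundary W) (n + 1), z ≠ 0),
      relativeSingularHomology.exists_linearEquiv_of_ne_zero ℤ n W h)
    (h6312 : ∀ (n : ℕ) (W : Type) [TopologicalSpace W] [T2Space W] [CompactSpace W]
      [ChartedSpace (EuclideanHalfSpace (n + 1)) W]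
      (z : relativeSingularHomology ℤ ℤ W ((𝓡∂ (n + 1)).boundary W) (n + 1))
      (hz : IsRelFundamentalClass ℤ ((𝓡∂ (n + 1)).boundary W) z) (p q : ℕ) (h : p + q = n + 1),
      bijective_relCapProduct_of_isRelFundamentalClass ℤ n W z hz h) :
    NullCobordism.isHomotopyEquiv_compl_ball_of_contractibleSpace :=
  isHomotopyEquiv_compl_ball_of_contractibleSpace_of_facts
    (whitehead_exists_homotopyEquiv_of_facts hWh hHu)
    (exists_cwComplex_homotopyEquiv_of_compactSpace_of_facts h7 h11)
    (exists_cwComplex_homotopyEquiv_of_compactSpace_boundary_of_facts h7 h11)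
    h635 h6312 (fun W _ k => injective_kroneckerMap_of_free_holds ℤ W k)

end NullCobordism

/-- **Kervaire–Milnor's Lemma 2.3 (`⇐`) from the six deep facts**: a closed simply connected
smooth `n`-manifold, `n ≥ 2`, bounding a contractible manifold is h-cobordant to `𝕊ⁿ`
(`isHCobordant_sphere_of_boundsContractible`, `HomotopySpheresInverse.lean`), GIVEN Hatcher
Thm. 4.5, Miller Cor. 65.7, Hatcher Thm. A.7 and Prop. A.11, Spanier Thm. 6.3.5 and Thm. 6.3.12 —
the ball-removal cobordism being the tree theorem
`NullCobordism.exists_cobordism_sphere_homeomorph_compl_ball`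
(`isHCobordant_sphere_of_boundsContractible_of_whitehead`). [cite: KervaireMilnorAnnals1963, Lemma 2.3 (pp. 506–507)] -/
theorem isHCobordant_sphere_of_boundsContractible_of_deep_facts
    (hWh : whitehead_exists_homotopyEquiv_of_isWeakHomotopyEquiv.{0, 0})
    (hHu : isWeakHomotopyEquiv_of_isIso_singularHomologyMap.{0})
    (h7 : isNeighbourhoodRetract_of_locallyContractibleSpace)
    (h11 : exists_cwComplex_homotopyEquiv_of_dominated.{0})
    (h635 : ∀ (n : ℕ) (W : Type) [TopologicalSpace W] [T2Space W] [CompactSpace W]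
      [ConnectedSpace W] [ChartedSpace (EuclideanHalfSpace (n + 1)) W]
      (h : ∃ z : relativeSingularHomology ℤ ℤ W ((𝓡∂ (n + 1)).boundary W) (n + 1), z ≠ 0),
      relativeSingularHomology.exists_linearEquiv_of_ne_zero ℤ n W h)
    (h6312 : ∀ (n : ℕ) (W : Type) [TopologicalSpace W] [T2Space W] [CompactSpace W]
      [ChartedSpace (EuclideanHalfSpace (n + 1)) W]
      (z : relativeSingularHomology ℤ ℤ W ((𝓡∂ (n + 1)).boundary W) (n + 1))
      (hz : IsRelFundamentalClass ℤ ((𝓡∂ (n + 1)).boundary W) z) (p q : ℕ) (h : p + q = n + 1),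
      bijective_relCapProduct_of_isRelFundamentalClass ℤ n W z hz h) :
    isHCobordant_sphere_of_boundsContractible :=
  isHCobordant_sphere_of_boundsContractible_of_whitehead
    (whitehead_exists_homotopyEquiv_of_facts hWh hHu)
    (exists_cwComplex_homotopyEquiv_of_compactSpace_of_facts h7 h11)
    (exists_cwComplex_homotopyEquiv_of_compactSpace_boundary_of_facts h7 h11)
    (NullCobordism.isIso_singularHomology_map_inclToComplCenter_of_lefschetz h635 h6312
      fun W _ k => injective_kroneckerMap_of_free_holds ℤ W k)

end Literature.Topology.FourManifolds

end
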